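import Mathlib.Analysis.SpecialFunctions.Elliptic.Weierstrass
import Literature.NumberTheory.EllipticCurves.WeierstrassAdditionProofs
import HarnessLib

/-!
# Line `star` (crux E1M, stmt-BirchSwinnertonDyer-20341), stub `StarPlusOddClass` — helper 2: the half-period values of `℘` are EXACTLY
# the roots of the Weierstrass cubic `4X³ − g₂X − g₃`

Lead bsd-rank2-star-p1 GEN 4.  For a Mathlib `PeriodPair` `L` (lattice `Λ = ℤω₁ ⊕ ℤω₂`): `℘'` vanishes at every half-period `h`
(`h ∉ Λ`, `2h ∈ Λ`; `℘'` is odd and `Λ`-periodic), so `e = ℘(h)` is a root of `4X³ − g₂X − g₃` (`derivWeierstrassP_sq`); the three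
values `e₁ = ℘(ω₁/2)`, `e₂ = ℘(ω₂/2)`, `e₃ = ℘((ω₁+ω₂)/2)` are pairwise distinct (`weierstrassP_eq_weierstrassP_iff`, tree
`WeierstrassAdditionProofs`: `℘(u) = ℘(v) ⟺ u ≡ ±v (mod Λ)`), hence `e₁ + e₂ + e₃ = 0`, `4X³ − g₂X − g₃ = 4(X − e₁)(X − e₂)(X − e₃)`, and
EVERY root of the cubic is one of the three half-period values.  This is step (iv)+(iii, algebraic half) of the road to `StarPlusOddClass`
(Lines/star.lean v4.0): a rational 2-torsion `x₀` of a curve with Néron pair `L` has `x₀ + b₂/12` a root of the cubic, hence `= ℘(h)` for a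
half-period `h`.  No real structure is used here.
-/

set_option linter.dupNamespace false

namespace Summit.BirchSwinnertonDyer.BirchSwinnertonDyer.Theorems.DepletionAtTwo

open PeriodPair

variable (L : PeriodPair)

/-- `℘'` vanishes at a half-period (`h ∉ Λ`, `2h ∈ Λ`): `℘'(h) = ℘'(h − 2h) = ℘'(−h) = −℘'(h)`. [folklore] -/
theorem derivWeierstrassP_eq_zero_of_two_mul_mem {h : ℂ} (h2 : 2 * h ∈ L.lattice) : L.derivWeierstrassP h = 0 := by
  have h1 : L.derivWeierstrassP (-h + (⟨2 * h, h2⟩ : L.lattice)) = L.derivWeierstrassP (-h) :=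
    L.derivWeierstrassP_add_coe (-h) ⟨2 * h, h2⟩
  have h3 : (-h + ((⟨2 * h, h2⟩ : L.lattice) : ℂ)) = h := by push_cast; ring
  rw [h3, L.derivWeierstrassP_neg] at h1
  linear_combination h1 / 2

/-- A half-period value `e = ℘(h)` is a root of the Weierstrass cubic: `4e³ − g₂e − g₃ = ℘'(h)² = 0`. [folklore] -/
theorem cubic_weierstrassP_eq_zero_of_two_mul_mem {h : ℂ} (hh : h ∉ L.lattice) (h2 : 2 * h ∈ L.lattice) :
    4 * L.weierstrassP h ^ 3 - L.g₂ * L.weierstrassP h - L.g₃ = 0 := by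
  rw [← L.derivWeierstrassP_sq h hh, derivWeierstrassP_eq_zero_of_two_mul_mem L h2]
  ring

/-- The third half-period `(ω₁ + ω₂)/2` is not a period. [folklore] -/
theorem half_ω₁_add_ω₂_notMem_lattice : (L.ω₁ + L.ω₂) / 2 ∉ L.lattice := by
  have h := (L.mul_ω₁_add_mul_ω₂_mem_lattice (α := 1 / 2) (β := 1 / 2)).not.mpr (by norm_num)
  intro hmem
  apply h
  convert hmem using 1
  push_cast
  ring

/-- `(ω₁ − ω₂)/2` is not a period. [folklore] -/
theorem half_ω₁_sub_ω₂_notMem_lattice : (L.ω₁ - L.ω₂) / 2 ∉ L.lattice := by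
  have h := (L.mul_ω₁_add_mul_ω₂_mem_lattice (α := 1 / 2) (β := -1 / 2)).not.mpr (by norm_num)
  intro hmem
  apply h
  convert hmem using 1
  push_cast
  ring

/-- The three half-period values of `℘` are pairwise distinct (`℘(u) = ℘(v) ⟺ u ≡ ±v (mod Λ)`). [folklore] -/
theorem weierstrassP_halfPeriods_ne :
    L.weierstrassP (L.ω₁ / 2) ≠ L.weierstrassP (L.ω₂ / 2) ∧
      L.weierstrassP (L.ω₁ / 2) ≠ L.weierstrassP ((L.ω₁ + L.ω₂) / 2) ∧
      L.weierstrassP (L.ω₂ / 2) ≠ L.weierstrassP ((L.ω₁ + L.ω₂) / 2) := by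
  have h1 := L.ω₁_div_two_notMem_lattice
  have h2 := L.ω₂_div_two_notMem_lattice
  have h3 := half_ω₁_add_ω₂_notMem_lattice L
  have h4 := half_ω₁_sub_ω₂_notMem_lattice L
  refine ⟨fun h ↦ ?_, fun h ↦ ?_, fun h ↦ ?_⟩
  · rcases (L.weierstrassP_eq_weierstrassP_iff h1 h2).mp h with h' | h'
    · exact h3 (by convert h' using 1; ring)
    · exact h4 (by convert h' using 1; ring)
  · rcases (L.weierstrassP_eq_weierstrassP_iff h1 h3).mp h with h' | h'
    · -- ω₁/2 + (ω₁+ω₂)/2 = ω₁ + ω₂/2 ∈ Λ ⇒ ω₂/2 ∈ Λ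
      apply h2
      have : L.ω₂ / 2 = (L.ω₁ / 2 + (L.ω₁ + L.ω₂) / 2) - L.ω₁ := by ring
      rw [this]
      exact sub_mem h' L.ω₁_mem_lattice
    · apply h2
      have : L.ω₂ / 2 = -(L.ω₁ / 2 - (L.ω₁ + L.ω₂) / 2) := by ring
      rw [this]
      exact neg_mem h'
  · rcases (L.weierstrassP_eq_weierstrassP_iff h2 h3).mp h with h' | h'
    · apply h1
      have : L.ω₁ / 2 = (L.ω₂ / 2 + (L.ω₁ + L.ω₂) / 2) - L.ω₂ := by ring
      rw [this]
      exact sub_mem h' L.ω₂_mem_lattice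
    · apply h1
      have : L.ω₁ / 2 = -(L.ω₂ / 2 - (L.ω₁ + L.ω₂) / 2) := by ring
      rw [this]
      exact neg_mem h'

/-- **The roots of `4X³ − g₂X − g₃` are exactly the three half-period values of `℘`.**  With `e₁ = ℘(ω₁/2)`, `e₂ = ℘(ω₂/2)`,
`e₃ = ℘((ω₁+ω₂)/2)`: `e₁ + e₂ + e₃ = 0` and `4X³ − g₂X − g₃ = 4(X − e₁)(X − e₂)(X − e₃)`, so any root `X` is one of them. [folklore] -/
theorem eq_weierstrassP_halfPeriod_of_cubic_eq_zero {X : ℂ} (hX : 4 * X ^ 3 - L.g₂ * X - L.g₃ = 0) :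
    X = L.weierstrassP (L.ω₁ / 2) ∨ X = L.weierstrassP (L.ω₂ / 2) ∨ X = L.weierstrassP ((L.ω₁ + L.ω₂) / 2) := by
  set e₁ := L.weierstrassP (L.ω₁ / 2) with he₁
  set e₂ := L.weierstrassP (L.ω₂ / 2) with he₂
  set e₃ := L.weierstrassP ((L.ω₁ + L.ω₂) / 2) with he₃
  obtain ⟨h12, h13, h23⟩ := weierstrassP_halfPeriods_ne L
  have r₁ : 4 * e₁ ^ 3 - L.g₂ * e₁ - L.g₃ = 0 :=
    cubic_weierstrassP_eq_zero_of_two_mul_mem L L.ω₁_div_two_notMem_lattice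
      (by rw [mul_div_cancel₀ _ (two_ne_zero' ℂ)]; exact L.ω₁_mem_lattice)
  have r₂ : 4 * e₂ ^ 3 - L.g₂ * e₂ - L.g₃ = 0 :=
    cubic_weierstrassP_eq_zero_of_two_mul_mem L L.ω₂_div_two_notMem_lattice
      (by rw [mul_div_cancel₀ _ (two_ne_zero' ℂ)]; exact L.ω₂_mem_lattice)
  have r₃ : 4 * e₃ ^ 3 - L.g₂ * e₃ - L.g₃ = 0 :=
    cubic_weierstrassP_eq_zero_of_two_mul_mem L (half_ω₁_add_ω₂_notMem_lattice L)
      (by rw [mul_div_cancel₀ _ (two_ne_zero' ℂ)]; exact add_mem L.ω₁_mem_lattice L.ω₂_mem_lattice)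
  -- `g₂ = 4(e₁² + e₁e₂ + e₂²)` and `e₁ + e₂ + e₃ = 0`
  have hne12 : e₁ - e₂ ≠ 0 := sub_ne_zero.mpr h12
  have hne13 : e₁ - e₃ ≠ 0 := sub_ne_zero.mpr h13
  have hne23 : e₂ - e₃ ≠ 0 := sub_ne_zero.mpr h23
  have hg12 : L.g₂ = 4 * (e₁ ^ 2 + e₁ * e₂ + e₂ ^ 2) := by
    have : (e₁ - e₂) * (4 * (e₁ ^ 2 + e₁ * e₂ + e₂ ^ 2) - L.g₂) = 0 := by linear_combination r₁ - r₂
    have := (mul_eq_zero.mp this).resolve_left hne12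
    linear_combination -this
  have hg13 : L.g₂ = 4 * (e₁ ^ 2 + e₁ * e₃ + e₃ ^ 2) := by
    have : (e₁ - e₃) * (4 * (e₁ ^ 2 + e₁ * e₃ + e₃ ^ 2) - L.g₂) = 0 := by linear_combination r₁ - r₃
    have := (mul_eq_zero.mp this).resolve_left hne13
    linear_combination -this
  have hsum : e₁ + e₂ + e₃ = 0 := by
    have : (e₂ - e₃) * (4 * (e₁ + e₂ + e₃)) = 0 := by linear_combination hg13 - hg12
    have := (mul_eq_zero.mp this).resolve_left hne23
    linear_combination this / 4
  have hfac : 4 * (X - e₁) * (X - e₂) * (X - e₃) = 0 := by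
    linear_combination hX - r₁ + (X - e₁) * hg12 - 4 * (X - e₁) * (X - e₂) * hsum
  rcases mul_eq_zero.mp hfac with h | h
  · rcases mul_eq_zero.mp h with h | h
    · rcases mul_eq_zero.mp h with h | h
      · norm_num at h
      · exact Or.inl (sub_eq_zero.mp h)
    · exact Or.inr (Or.inl (sub_eq_zero.mp h))
  · exact Or.inr (Or.inr (sub_eq_zero.mp h))

end Summit.BirchSwinnertonDyer.BirchSwinnertonDyer.Theorems.DepletionAtTwo
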